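import Summits.CriticalPhenomena.CardyFormulaZ2.Theorems.CardyIKTransportIKMixedBoxCrossingDefectGlueColDefs
import Summits.CriticalPhenomena.CardyFormulaZ2.Theorems.CardyIKTransportIKMixedBoxCrossingDefectStubRowGlue

/-!
# Stub `stub_colGlue` of the line `defect-closure-exploration` (crux `IKMixedBoxCrossing`,
# stmt-CriticalPhenomena-5911)

COLUMN GLUING (the Cauchy–Schwarz junction across the anchor cell column `0`, every column pattern `S`):
`ColFactorisation → ColGluing`, i.e. `glueFirstCol² ≤ ν(W crossed horizontally) · glueSecondCol` for the wide
box `W = [-h, h] × [b, b+k)` cut by the cell column `0` — the transpose (rows ↔ columns) of `stub_rowGlue`,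
whose abstract tools (`RowGlueStub.sq_sum_real_le`, `RowGlueStub.sum_real_inter_cyl`,
`RowGlueStub.real_inter_inter_cyl`, `RowGlueStub.measurableSet_arm`, `RowGlueStub.arm_mem_determinedOn`) are
reused as they are.

PROOF (no integrals, no literature fact).
* GLUE EVENTS. For a row `j < k` let `E_j = rtArm_j ∩ lfArm_j ∩ {(0, b+j) black}`. POINTWISE GLUE
  (`glue_subset`): on `E_j` the black path inside the left half-box from its left column to `(-1, b+j)`, the
  two horizontal edges through the black axis cell `(0, b+j)` (present in every triangulation) and the black
  path inside the right half-box from `(1, b+j)` to its right column concatenate inside `W` to a left–right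
  crossing: `E_j ⊆ T := lrCross`.
* MOMENTS (`glueFirstCol_eq`, `glueSecondCol_eq`). The axis-column cylinders `C_ζ`, `ζ : Fin k → Bool`,
  partition the observables (`sum_real_inter_colCyl`) and on `C_ζ` the axis colour events are all or nothing
  (`real_inter_inter_colCyl`); the arm events are measurable and determined by their half-boxes (an arm reads
  the colours of the box cells and the anti-diagonal flags of faces that are themselves box cells), so
  `ColFactorisation` turns `glueFirstCol` into `Σ_j ν(E_j)` and `glueSecondCol` into `Σ_{i,j} ν(E_i ∩ E_j)`.
* CAUCHY–SCHWARZ (`RowGlueStub.sq_sum_real_le`): for measurable `E_j ⊆ T`,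
  `(Σ_j ν(E_j))² ≤ ν(T) Σ_{i,j} ν(E_i ∩ E_j)`.
-/

noncomputable section

namespace Summit.CriticalPhenomena.CardyFormulaZ2.Cruxes.IKMixedBoxCrossing.DefectClosureExploration

open scoped BigOperators Classical
open MeasureTheory Finset
open Literature.Probability.Percolation Literature.Probability.LatticeModels
open Summit.CriticalPhenomena.CardyFormulaZ2.Theorems.IKLinearTransport.PinnedDiagramExchange
  (Obs νmix blackEdges lrCross determinedOn isProbabilityMeasure_nuMix)
open Summit.CriticalPhenomena.CardyFormulaZ2.Theorems.IKLinearTransport.PinnedDiagramExchange.CouplingToLimits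
  (measurable_blackEdges mk_mem_blackEdges_iff)
open Summit.CriticalPhenomena.CardyFormulaZ2.Cruxes.IKMixedBoxCrossing.PairedMirrorExploration.PolyDoublingStub
  (inter_mem_determinedOn)
open RowGlueStub (sum_real_inter_cyl real_inter_inter_cyl sq_sum_real_le measurableSet_blk measurableSet_arm
  arm_mem_determinedOn)

namespace ColGlueStub

/-! ## §1 The axis-column cylinders and the arm events -/

/-- The axis-column cylinders `C_ζ` partition the observables: `Σ_ζ ν(D ∩ C_ζ) = ν(D)`. -/
theorem sum_real_inter_colCyl (S : Set ℤ) (b : ℤ) (k : ℕ) {D : Set Obs} (hD : MeasurableSet D) :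
    ∑ ζ : Fin k → Bool, (νmix S).real (D ∩ colCyl b k ζ) = (νmix S).real D := by
  haveI := isProbabilityMeasure_nuMix S
  exact sum_real_inter_cyl (νmix S) (fun j : Fin k => {x : Obs | (![0, b + j] : Site 2) ∈ x.1})
    (fun j => measurableSet_blk _) hD

/-- On the axis-column cylinder `C_ζ` the colour of the axis cell `(0, b+j)` is `ζ_j`. -/
theorem real_inter_inter_colCyl (S : Set ℤ) (b : ℤ) (k : ℕ) (D : Set Obs) (j : Fin k) (ζ : Fin k → Bool) :
    (νmix S).real (D ∩ {x : Obs | (![0, b + j] : Site 2) ∈ x.1} ∩ colCyl b k ζ) =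
      if ζ j = true then (νmix S).real (D ∩ colCyl b k ζ) else 0 :=
  real_inter_inter_cyl (νmix S) (fun j : Fin k => {x : Obs | (![0, b + j] : Site 2) ∈ x.1}) D j ζ

/-- The right half-box contains the face read by each of its anti-diagonal edges. -/
theorem rtBox_face (b : ℤ) (k h : ℕ) :
    ∀ u ∈ rtBox b k h, ∀ v ∈ rtBox b k h, v = u + ![1, -1] → u + ![0, -1] ∈ rtBox b k h := by
  intro u hu v hv huv
  subst huv
  simp only [rtBox, Set.mem_setOf_eq, Pi.add_apply, Matrix.cons_val_zero, Matrix.cons_val_one] at hu hv ⊢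
  omega

/-- The left half-box contains the face read by each of its anti-diagonal edges. -/
theorem lfBox_face (b : ℤ) (k h : ℕ) :
    ∀ u ∈ lfBox b k h, ∀ v ∈ lfBox b k h, v = u + ![1, -1] → u + ![0, -1] ∈ lfBox b k h := by
  intro u hu v hv huv
  subst huv
  simp only [lfBox, Set.mem_setOf_eq, Pi.add_apply, Matrix.cons_val_zero, Matrix.cons_val_one] at hu hv ⊢
  omega

/-- The right arm event is measurable. -/
theorem measurableSet_rtArm {b : ℤ} {k h : ℕ} {j : Fin k} : MeasurableSet (rtArm b k h j) :=
  measurableSet_arm (rtBox b k h) (rtCol b k h) ![1, b + j]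

/-- The left arm event is measurable. -/
theorem measurableSet_lfArm {b : ℤ} {k h : ℕ} {j : Fin k} : MeasurableSet (lfArm b k h j) :=
  measurableSet_arm (lfBox b k h) (lfCol b k h) ![-1, b + j]

/-- The right arm event is determined by the right half-box. -/
theorem rtArm_mem {b : ℤ} {k h : ℕ} {j : Fin k} : rtArm b k h j ∈ determinedOn (rtBox b k h) :=
  arm_mem_determinedOn (X := rtBox b k h) (Tgt := rtCol b k h) (c := ![1, b + j]) (rtBox_face b k h)

/-- The left arm event is determined by the left half-box. -/
theorem lfArm_mem {b : ℤ} {k h : ℕ} {j : Fin k} : lfArm b k h j ∈ determinedOn (lfBox b k h) :=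
  arm_mem_determinedOn (X := lfBox b k h) (Tgt := lfCol b k h) (c := ![-1, b + j]) (lfBox_face b k h)

/-! ## §2 Pointwise glue -/

/-- POINTWISE GLUE: a left arm at row `j`, the black axis cell `(0, b+j)` and a right arm at row `j`
concatenate (through the two horizontal edges at the axis cell, present in every triangulation) to a
left–right crossing of the wide box `[-h, h] × [b, b+k)`. -/
theorem glue_subset (b : ℤ) (k h : ℕ) (j : Fin k) :
    rtArm b k h j ∩ lfArm b k h j ∩ {x | (![0, b + j] : Site 2) ∈ x.1} ⊆
      lrCross (-(h : ℤ)) b (2 * h + 1) k := by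
  rintro x ⟨⟨⟨hb1, s, hs, t, ht, hst⟩, hb2, s', hs', t', ht', hst'⟩, h0⟩
  rw [Set.mem_singleton_iff] at hs hs'
  subst hs hs'
  have hjk : (j : ℕ) < k := j.isLt
  have hh : (1 : ℤ) ≤ h := by
    obtain ⟨hs1, -, -⟩ := hst
    have := hs1.2.1
    simpa using this
  set R : Set (Site 2) :=
    {v | -(h : ℤ) ≤ v 0 ∧ v 0 < -(h : ℤ) + ((2 * h + 1 : ℕ) : ℤ) ∧ b ≤ v 1 ∧ v 1 < b + k} with hR
  have hRt : rtBox b k h ⊆ R := fun v hv => by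
    simp only [rtBox, hR, Set.mem_setOf_eq] at hv ⊢; push_cast; omega
  have hLf : lfBox b k h ⊆ R := fun v hv => by
    simp only [lfBox, hR, Set.mem_setOf_eq] at hv ⊢; push_cast; omega
  have hm : ∀ m : ℤ, -1 ≤ m → m ≤ 1 → (![m, b + j] : Site 2) ∈ R := fun m hm1 hm2 => by
    simp only [hR, Set.mem_setOf_eq, Matrix.cons_val_zero, Matrix.cons_val_one]
    push_cast; omega
  have e1 : s(![0, b + j], ![1, b + j]) ∈ blackEdges x :=
    (mk_mem_blackEdges_iff _ _ _).2 (Or.inl ⟨h0, hb1, Or.inl (by ext l; fin_cases l <;> simp)⟩)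
  have e2 : s(![-1, b + j], ![0, b + j]) ∈ blackEdges x :=
    (mk_mem_blackEdges_iff _ _ _).2 (Or.inl ⟨hb2, h0, Or.inl (by ext l; fin_cases l <;> simp)⟩)
  have ne1 : (![0, b + j] : Site 2) ≠ ![1, b + j] := fun e => by simpa using congrFun e 0
  have ne2 : (![-1, b + j] : Site 2) ≠ ![0, b + j] := fun e => by simpa using congrFun e 0
  have c1 : blackEdges x ∈ openConnIn R t' ![-1, b + j] := by
    rw [openConnIn_comm]; exact openConnIn_mono hLf _ _ hst'
  have c2 : blackEdges x ∈ openConnIn R ![-1, b + j] ![0, b + j] :=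
    openConnIn_of_adj (hm (-1) (by norm_num) (by norm_num)) (hm 0 (by norm_num) (by norm_num)) e2 ne2
  have c3 : blackEdges x ∈ openConnIn R ![0, b + j] ![1, b + j] :=
    openConnIn_of_adj (hm 0 (by norm_num) (by norm_num)) (hm 1 (by norm_num) (by norm_num)) e1 ne1
  have c4 : blackEdges x ∈ openConnIn R ![1, b + j] t := openConnIn_mono hRt _ _ hst
  refine ⟨t', ht', t, ?_, PlanarDuality.openConnIn_trans (PlanarDuality.openConnIn_trans c1 c2)
    (PlanarDuality.openConnIn_trans c3 c4)⟩
  simp only [rtCol, Set.mem_setOf_eq] at ht ⊢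
  push_cast
  omega

/-! ## §3 The two moments -/

/-- FIRST MOMENT: by `ColFactorisation`, `glueFirstCol = Σ_j ν(rtArm_j ∩ lfArm_j ∩ {(0,b+j) black})`. -/
theorem glueFirstCol_eq (hCF : ColFactorisation) (S : Set ℤ) (b : ℤ) (k h : ℕ) :
    glueFirstCol S b k h =
      ∑ j : Fin k, (νmix S).real (rtArm b k h j ∩ lfArm b k h j ∩ {x | (![0, b + j] : Site 2) ∈ x.1}) := by
  refine sum_congr rfl fun j _ => ?_
  rw [← sum_real_inter_colCyl S b k
    ((measurableSet_rtArm.inter measurableSet_lfArm).inter (measurableSet_blk _))]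
  refine sum_congr rfl fun ζ _ => ?_
  rw [real_inter_inter_colCyl,
    hCF S b k h _ _ measurableSet_rtArm measurableSet_lfArm rtArm_mem lfArm_mem ζ]

/-- SECOND MOMENT: by `ColFactorisation`, `glueSecondCol = Σ_{i,j} ν(E_i ∩ E_j)` for the glue events
`E_j = rtArm_j ∩ lfArm_j ∩ {(0,b+j) black}`. -/
theorem glueSecondCol_eq (hCF : ColFactorisation) (S : Set ℤ) (b : ℤ) (k h : ℕ) :
    glueSecondCol S b k h =
      ∑ i : Fin k, ∑ j : Fin k, (νmix S).real
        (rtArm b k h i ∩ lfArm b k h i ∩ {x | (![0, b + i] : Site 2) ∈ x.1} ∩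
          (rtArm b k h j ∩ lfArm b k h j ∩ {x | (![0, b + j] : Site 2) ∈ x.1})) := by
  refine sum_congr rfl fun i _ => sum_congr rfl fun j _ => ?_
  rw [← sum_real_inter_colCyl S b k
    (((measurableSet_rtArm.inter measurableSet_lfArm).inter (measurableSet_blk _)).inter
      ((measurableSet_rtArm.inter measurableSet_lfArm).inter (measurableSet_blk _)))]
  refine sum_congr rfl fun ζ _ => ?_
  rw [show rtArm b k h i ∩ lfArm b k h i ∩ {x | (![0, b + i] : Site 2) ∈ x.1} ∩
      (rtArm b k h j ∩ lfArm b k h j ∩ {x | (![0, b + j] : Site 2) ∈ x.1}) ∩ colCyl b k ζ =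
      rtArm b k h i ∩ rtArm b k h j ∩ (lfArm b k h i ∩ lfArm b k h j) ∩
        {x | (![0, b + i] : Site 2) ∈ x.1} ∩ {x | (![0, b + j] : Site 2) ∈ x.1} ∩ colCyl b k ζ from
      Set.ext fun x => by simp only [Set.mem_inter_iff]; tauto,
    real_inter_inter_colCyl, real_inter_inter_colCyl,
    hCF S b k h _ _ (measurableSet_rtArm.inter measurableSet_rtArm)
      (measurableSet_lfArm.inter measurableSet_lfArm) (inter_mem_determinedOn rtArm_mem rtArm_mem)
      (inter_mem_determinedOn lfArm_mem lfArm_mem) ζ]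
  by_cases hi : ζ i = true <;> by_cases hj : ζ j = true <;> simp [hi, hj]

end ColGlueStub

/-- **Registered stub `stub_colGlue`** (COLUMN GLUING, line `defect-closure-exploration`): the second-moment
junction across the anchor cell column `0`, for every column pattern `S` — with `M` the number of rows `j`
carrying a right arm, a black axis cell `(0, b+j)` and a left arm (each such row glues a horizontal crossing of
the wide box `W = [-h, h] × [b, b+k)`), Cauchy–Schwarz `(E M)² ≤ E M² · ν(W crossed horizontally)` and
`ColFactorisation` (which makes both moments the explicit sums `glueFirstCol`, `glueSecondCol`) give
`glueFirstCol² ≤ ν(lrCross (-h) b (2h+1) k) · glueSecondCol`. Transpose of `stub_rowGlue`. -/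
theorem stub_colGlue : ColFactorisation → ColGluing := by
  intro hCF S b k h
  haveI := isProbabilityMeasure_nuMix S
  have hT : MeasurableSet (lrCross (-(h : ℤ)) b (2 * h + 1) k) := by
    unfold lrCross
    exact measurable_blackEdges (measurableSet_openCrossing_of_countable _ _ _)
  rw [ColGlueStub.glueFirstCol_eq hCF, ColGlueStub.glueSecondCol_eq hCF]
  exact RowGlueStub.sq_sum_real_le (νmix S)
    (fun j : Fin k => rtArm b k h j ∩ lfArm b k h j ∩ {x | (![0, b + j] : Site 2) ∈ x.1})
    (fun j => (ColGlueStub.measurableSet_rtArm.inter ColGlueStub.measurableSet_lfArm).inter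
      (RowGlueStub.measurableSet_blk _))
    hT (ColGlueStub.glue_subset b k h)

end Summit.CriticalPhenomena.CardyFormulaZ2.Cruxes.IKMixedBoxCrossing.DefectClosureExploration

end
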